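import Summits.HubbardSuperconductivity.HubbardSuperconductivity.Theorems.TwTipContinuation.Negative.TipNormalForm
import Summits.HubbardSuperconductivity.HubbardSuperconductivity.Theorems.ThermalWedgeTwTipContinuationEdgeOrderProductState
import Literature.MathematicalPhysics.QuantumLattice.PatchPairOperator
import Literature.MathematicalPhysics.QuantumLattice.TorusCooperSum

/-!
# `TwTipContinuation` (stmt-HubbardSuperconductivity-1700), line `isogap-submodular-transport`,
# stub `stub_edgeOrder` — piece 3a(ii): the algebra of adding one `↑↓` pair in momentum space

CAR bookkeeping for the pair-addition cost of the seeded `U = 0` torus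
`H = T − (c/L²) Δ_dᴴ Δ_d` (`T = hubbardTorus 2 L 1 0 = Σ_{kσ} ε_L(k) n_{kσ}`,
`Δ_d = pairField dWaveFormFactor L = −2√2 Σ_k ĝ_d(k) b_k`): for the two-mode creator
`A_{kq} = c†_{k↑} c†_{q↓}`,
* `A_{kq}` maps the sector `(m,m)` to `(m+1,m+1)` (`isInSector_pairCreator_mulVec`);
* `A_{kq}ᴴ A_{kq} = (1 − n_{k↑})(1 − n_{q↓})`, and per-spin Parseval `Σ_k n_{kσ} = Σ_x n_{xσ}` with
  `N_σ ψ = m ψ` on the sector give `Σ_{k,q} ‖A_{kq} ψ‖² = (L² − m)²` for a unit `ψ` there;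
* the commutators `[T, A_{kq}] = (ε_L(k) + ε_L(q)) A_{kq}` (`L ≥ 3`),
  `[Σ_p ĝ(p) b_p, A_{kq}] = ĝ(k) c_{−k↓} c†_{q↓} − ĝ(−q) c†_{k↑} c_{−q↑}`, and `Δᴴ A = A Δᴴ`.
Folklore second-quantisation identities (Bratteli–Robinson II §5.2; von Delft–Ralph 2001 §4.2).
-/

noncomputable section

namespace Summit.HubbardSuperconductivity.TwTipContinuation.IsogapTransport

open Matrix Finset
open Literature.MathematicalPhysics.QuantumLattice Literature.Probability.LatticeModels
open scoped ComplexOrder ComplexConjugate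

/-! ### Per-spin Parseval and the spin-resolved particle numbers -/

section Parseval

variable {L : ℕ} [NeZero L]

/-- **Per-spin Parseval**: `Σ_k n_{kσ} = Σ_x n_{xσ}`. [folklore] -/
theorem sum_momentumNumber_eq_sum_numberOp (σ : Fin 2) :
    ∑ k : TorusSite 2 L, momentumNumber k σ = ∑ x : FermionTorus 2 L, numberOp x σ := by
  have hk : ∀ k : TorusSite 2 L, momentumNumber k σ = ∑ x : FermionTorus 2 L, ∑ y : FermionTorus 2 L,
      (torusFourierWeight 2 L * torusChar k x.toTorusSite * (torusFourierWeight 2 L * conj (torusChar k y.toTorusSite))) •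
        (creation (orb x σ) * annihilation (orb y σ)) := by
    intro k
    rw [momentumNumber, momentumCreation_eq_sum, momentumAnnihilation, Finset.sum_mul_sum]
    refine Finset.sum_congr rfl fun x _ => Finset.sum_congr rfl fun y _ => ?_
    rw [smul_mul_smul_comm]
  simp_rw [hk]
  rw [Finset.sum_comm]
  refine Finset.sum_congr rfl fun x _ => ?_
  rw [Finset.sum_comm]
  simp_rw [← Finset.sum_smul, sum_torusFourierWeight_mul_torusChar_mul_conj, ite_smul, one_smul, zero_smul]
  rw [Finset.sum_ite_eq, if_pos (Finset.mem_univ x), numberOp]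

end Parseval

section Generic

variable {Λ : Type*} [LinearOrder Λ] [Fintype Λ]

/-- The spin-`↑` number acts diagonally: `(Σ_x n_{x↑}) ψ (s) = #upPart(s) · ψ(s)`. [folklore] -/
theorem sum_numberOp_up_mulVec_apply (ψ : Fock (Orb Λ)) (s : Finset (Orb Λ)) :
    ((∑ x : Λ, numberOp x 0) *ᵥ ψ) s = ((upPart s).card : ℂ) * ψ s := by
  rw [sum_mulVec, Finset.sum_apply]
  have : ∀ x : Λ, (numberOp x 0 *ᵥ ψ) s = (if orb x 0 ∈ s then 1 else 0) * ψ s := fun x => by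
    rw [numberOp, ← numberAt, numberAt_eq_diagonal, mulVec_diagonal]
  simp_rw [this]
  rw [← Finset.sum_mul, Finset.sum_boole, upPart]

/-- `(Σ_x n_{x↓}) ψ (s) = #downPart(s) · ψ(s)`. [folklore] -/
theorem sum_numberOp_down_mulVec_apply (ψ : Fock (Orb Λ)) (s : Finset (Orb Λ)) :
    ((∑ x : Λ, numberOp x 1) *ᵥ ψ) s = ((downPart s).card : ℂ) * ψ s := by
  rw [sum_mulVec, Finset.sum_apply]
  have : ∀ x : Λ, (numberOp x 1 *ᵥ ψ) s = (if orb x 1 ∈ s then 1 else 0) * ψ s := fun x => by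
    rw [numberOp, ← numberAt, numberAt_eq_diagonal, mulVec_diagonal]
  simp_rw [this]
  rw [← Finset.sum_mul, Finset.sum_boole, downPart]

/-- On the sector `(a,b)`: `(Σ_x n_{x↑}) ψ = a ψ`. [folklore] -/
theorem sum_numberOp_up_mulVec {a b : ℕ} {ψ : Fock (Orb Λ)} (hψ : IsInSector a b ψ) :
    (∑ x : Λ, numberOp x 0) *ᵥ ψ = (a : ℂ) • ψ := by
  funext s
  rw [sum_numberOp_up_mulVec_apply, Pi.smul_apply, smul_eq_mul]
  by_cases hs : (upPart s).card = a ∧ (downPart s).card = b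
  · rw [hs.1]
  · rw [hψ s hs, mul_zero, mul_zero]

/-- On the sector `(a,b)`: `(Σ_x n_{x↓}) ψ = b ψ`. [folklore] -/
theorem sum_numberOp_down_mulVec {a b : ℕ} {ψ : Fock (Orb Λ)} (hψ : IsInSector a b ψ) :
    (∑ x : Λ, numberOp x 1) *ᵥ ψ = (b : ℂ) • ψ := by
  funext s
  rw [sum_numberOp_down_mulVec_apply, Pi.smul_apply, smul_eq_mul]
  by_cases hs : (upPart s).card = a ∧ (downPart s).card = b
  · rw [hs.2]
  · rw [hψ s hs, mul_zero, mul_zero]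

/-- A matrix of grade `(1,1)` maps the sector `(m,m)` into `(m+1,m+1)`. [folklore] -/
theorem isInSector_mulVec_of_shifts_one_one {M : Matrix (Finset (Orb Λ)) (Finset (Orb Λ)) ℂ}
    (hM : PairChirality.Shifts 1 1 M) {m : ℕ} {ψ : Fock (Orb Λ)} (hψ : IsInSector m m ψ) :
    IsInSector (m + 1) (m + 1) (M *ᵥ ψ) := by
  intro s hs
  rw [mulVec, dotProduct]
  refine Finset.sum_eq_zero fun t _ => ?_
  by_cases hMt : M s t = 0
  · rw [hMt, zero_mul]
  · have h := hM s t hMt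
    rw [hψ t, mul_zero]
    rintro ⟨h1, h2⟩
    apply hs
    constructor <;> omega

end Generic

section Torus

variable {L : ℕ} [NeZero L]

/-- On the sector `(a,b)`: `(Σ_k n_{k↑}) ψ = a ψ`. [folklore] -/
theorem sum_momentumNumber_up_mulVec {a b : ℕ} {ψ : Fock (Orb (FermionTorus 2 L))} (hψ : IsInSector a b ψ) :
    (∑ k : TorusSite 2 L, momentumNumber k 0) *ᵥ ψ = (a : ℂ) • ψ := by
  rw [sum_momentumNumber_eq_sum_numberOp]
  exact sum_numberOp_up_mulVec hψ

/-- On the sector `(a,b)`: `(Σ_k n_{k↓}) ψ = b ψ`. [folklore] -/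
theorem sum_momentumNumber_down_mulVec {a b : ℕ} {ψ : Fock (Orb (FermionTorus 2 L))} (hψ : IsInSector a b ψ) :
    (∑ k : TorusSite 2 L, momentumNumber k 1) *ᵥ ψ = (b : ℂ) • ψ := by
  rw [sum_momentumNumber_eq_sum_numberOp]
  exact sum_numberOp_down_mulVec hψ

/-! ### Sector bookkeeping of the two-mode creator -/

/-- `c†_{k↑}` has grade `(1,0)`. [folklore] -/
theorem shifts_momentumCreation_up (k : TorusSite 2 L) : PairChirality.Shifts 1 0 (momentumCreation k 0) := by
  rw [momentumCreation_eq_sum]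
  refine PairChirality.Shifts.sum fun x _ => PairChirality.Shifts.smul ?_ _
  have h := (PairChirality.shifts_annihilation_up (Λ := FermionTorus 2 L) x).conjTranspose
  rwa [annihilation_conjTranspose] at h

/-- `c†_{q↓}` has grade `(0,1)`. [folklore] -/
theorem shifts_momentumCreation_down (q : TorusSite 2 L) : PairChirality.Shifts 0 1 (momentumCreation q 1) := by
  rw [momentumCreation_eq_sum]
  refine PairChirality.Shifts.sum fun x _ => PairChirality.Shifts.smul ?_ _
  have h := (PairChirality.shifts_annihilation_down (Λ := FermionTorus 2 L) x).conjTranspose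
  rwa [annihilation_conjTranspose] at h

/-- `A_{kq} ψ = c†_{k↑} c†_{q↓} ψ` lies in the sector `(m+1,m+1)` if `ψ` lies in `(m,m)`. [folklore] -/
theorem isInSector_pairCreator_mulVec (k q : TorusSite 2 L) {m : ℕ} {ψ : Fock (Orb (FermionTorus 2 L))}
    (hψ : IsInSector m m ψ) : IsInSector (m + 1) (m + 1) ((momentumCreation k 0 * momentumCreation q 1) *ᵥ ψ) := by
  have h := (shifts_momentumCreation_up k).mul (shifts_momentumCreation_down q)
  simp only [add_zero, zero_add] at h
  exact isInSector_mulVec_of_shifts_one_one h hψ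

/-! ### `Aᴴ A` and the total squared norm of the pair-added vectors -/

/-- `A_{kq}ᴴ A_{kq} = (1 − n_{k↑})(1 − n_{q↓})`, written as `c_{k↑}c†_{k↑} · c_{q↓}c†_{q↓}`. [folklore] -/
theorem pairCreator_conjTranspose_mul_self (k q : TorusSite 2 L) :
    (momentumCreation k 0 * momentumCreation q 1)ᴴ * (momentumCreation k 0 * momentumCreation q 1) =
      (momentumAnnihilation k 0 * momentumCreation k 0) * (momentumAnnihilation q 1 * momentumCreation q 1) := by
  rw [conjTranspose_mul, momentumCreation_conjTranspose, momentumCreation_conjTranspose]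
  -- `c_q c_k c†_k c†_q`: move `c_k c†_k = 1 - n_k` past `c_q` (different modes)
  have h1 : momentumAnnihilation k 0 * momentumCreation k 0 = 1 - momentumNumber k 0 := by
    rw [momentumAnnihilation_mul_momentumCreation, if_pos ⟨rfl, rfl⟩, momentumNumber]
  have hcomm : momentumAnnihilation q 1 * (1 - momentumNumber k 0) = (1 - momentumNumber k 0) * momentumAnnihilation q 1 := by
    have hne : ¬ (k = q ∧ (0 : Fin 2) = 1) := fun h => absurd h.2 (by decide)
    have h := congrArg conjTranspose (momentumNumber_mul_momentumCreation_of_ne hne)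
    rw [conjTranspose_mul, conjTranspose_mul, momentumNumber_conjTranspose, momentumCreation_conjTranspose] at h
    rw [mul_sub, sub_mul, Matrix.mul_one, Matrix.one_mul, h]
  calc momentumAnnihilation q 1 * momentumAnnihilation k 0 * (momentumCreation k 0 * momentumCreation q 1)
      = momentumAnnihilation q 1 * (momentumAnnihilation k 0 * momentumCreation k 0) * momentumCreation q 1 := by
        simp only [Matrix.mul_assoc]
    _ = (momentumAnnihilation k 0 * momentumCreation k 0) * (momentumAnnihilation q 1 * momentumCreation q 1) := by
        rw [h1, hcomm, Matrix.mul_assoc]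

/-- `c_{qσ} c†_{qσ} ψ = ψ − n_{qσ} ψ`. [folklore] -/
theorem momentumAnnihilation_mul_momentumCreation_mulVec (q : TorusSite 2 L) (σ : Fin 2)
    (ψ : Fock (Orb (FermionTorus 2 L))) :
    (momentumAnnihilation q σ * momentumCreation q σ) *ᵥ ψ = ψ - momentumNumber q σ *ᵥ ψ := by
  rw [momentumAnnihilation_mul_momentumCreation, if_pos ⟨rfl, rfl⟩, sub_mulVec, one_mulVec, momentumNumber]

/-- `Σ_q c_{q↓} c†_{q↓} ψ = (L² − b) ψ` on the sector `(a,b)` (number of empty `↓` Bloch modes). [folklore] -/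
theorem sum_holeNumber_down_mulVec {a b : ℕ} {ψ : Fock (Orb (FermionTorus 2 L))} (hψ : IsInSector a b ψ) :
    ∑ q : TorusSite 2 L, (momentumAnnihilation q 1 * momentumCreation q 1) *ᵥ ψ = ((L : ℂ) ^ 2 - b) • ψ := by
  simp_rw [momentumAnnihilation_mul_momentumCreation_mulVec]
  rw [Finset.sum_sub_distrib, ← sum_mulVec, sum_momentumNumber_down_mulVec hψ, Finset.sum_const, Finset.card_univ,
    card_torusSite_two, sub_smul, ← Nat.cast_smul_eq_nsmul ℂ]
  push_cast
  rfl

/-- `Σ_k c_{k↑} c†_{k↑} ψ = (L² − a) ψ` on the sector `(a,b)`. [folklore] -/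
theorem sum_holeNumber_up_mulVec {a b : ℕ} {ψ : Fock (Orb (FermionTorus 2 L))} (hψ : IsInSector a b ψ) :
    ∑ k : TorusSite 2 L, (momentumAnnihilation k 0 * momentumCreation k 0) *ᵥ ψ = ((L : ℂ) ^ 2 - a) • ψ := by
  simp_rw [momentumAnnihilation_mul_momentumCreation_mulVec]
  rw [Finset.sum_sub_distrib, ← sum_mulVec, sum_momentumNumber_up_mulVec hψ, Finset.sum_const, Finset.card_univ,
    card_torusSite_two, sub_smul, ← Nat.cast_smul_eq_nsmul ℂ]
  push_cast
  rfl

/-- `c_{q↓} c†_{q↓}` preserves every sector. [folklore] -/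
theorem isInSector_holeNumber_down_mulVec (q : TorusSite 2 L) {a b : ℕ} {ψ : Fock (Orb (FermionTorus 2 L))}
    (hψ : IsInSector a b ψ) : IsInSector a b ((momentumAnnihilation q 1 * momentumCreation q 1) *ᵥ ψ) := by
  have h := (shifts_momentumCreation_down q).conjTranspose.mul (shifts_momentumCreation_down q)
  rw [momentumCreation_conjTranspose] at h
  simp only [neg_zero, Int.reduceNeg, add_zero, neg_add_cancel] at h
  exact h.preservesSectors.isInSector_mulVec hψ

/-- **Total squared norm of the pair-added vectors**: for a unit `ψ` in the sector `(m,m)`,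
`Σ_{k,q} ‖c†_{k↑} c†_{q↓} ψ‖² = (L² − m)²`. [folklore] -/
theorem sum_normSq_pairCreator_mulVec {m : ℕ} {ψ : Fock (Orb (FermionTorus 2 L))} (hψ : IsInSector m m ψ)
    (hψ1 : star ψ ⬝ᵥ ψ = 1) :
    ∑ k : TorusSite 2 L, ∑ q : TorusSite 2 L,
        star ((momentumCreation k 0 * momentumCreation q 1) *ᵥ ψ) ⬝ᵥ ((momentumCreation k 0 * momentumCreation q 1) *ᵥ ψ) =
      (((L : ℂ) ^ 2 - m)) ^ 2 := by
  have hkq : ∀ k q : TorusSite 2 L,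
      star ((momentumCreation k 0 * momentumCreation q 1) *ᵥ ψ) ⬝ᵥ ((momentumCreation k 0 * momentumCreation q 1) *ᵥ ψ) =
        star ψ ⬝ᵥ ((momentumAnnihilation k 0 * momentumCreation k 0) *ᵥ
          ((momentumAnnihilation q 1 * momentumCreation q 1) *ᵥ ψ)) := by
    intro k q
    rw [star_mulVec, ← dotProduct_mulVec, mulVec_mulVec, mulVec_mulVec, ← Matrix.mul_assoc,
      Matrix.mul_assoc ((momentumCreation k 0 * momentumCreation q 1)ᴴ), pairCreator_conjTranspose_mul_self]
  simp_rw [hkq]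
  rw [Finset.sum_comm]
  have h1 : ∀ q : TorusSite 2 L, ∑ k : TorusSite 2 L, star ψ ⬝ᵥ ((momentumAnnihilation k 0 * momentumCreation k 0) *ᵥ
      ((momentumAnnihilation q 1 * momentumCreation q 1) *ᵥ ψ)) =
      ((L : ℂ) ^ 2 - m) * (star ψ ⬝ᵥ ((momentumAnnihilation q 1 * momentumCreation q 1) *ᵥ ψ)) := fun q => by
    rw [← dotProduct_sum, sum_holeNumber_up_mulVec (isInSector_holeNumber_down_mulVec q hψ), dotProduct_smul,
      smul_eq_mul]
  rw [Finset.sum_congr rfl fun q _ => h1 q, ← Finset.mul_sum, ← dotProduct_sum, sum_holeNumber_down_mulVec hψ,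
    dotProduct_smul, hψ1, smul_eq_mul, mul_one]
  ring

/-- **Total squared norm of the pair-added vectors (piece 3a(ii) of `stub_edgeOrder`)**, closed
form: for a unit `ψ` in the sector `(m,m)` of the fermionic torus,
`Σ_{k,q} ‖c†_{k↑} c†_{q↓} ψ‖² = (L² − m)²`. [folklore] -/
theorem pairAddition_sum_normSq :
    ∀ (L : ℕ) [NeZero L] (m : ℕ) (ψ : Fock (Orb (FermionTorus 2 L))), IsInSector m m ψ → star ψ ⬝ᵥ ψ = 1 → ∑ k : TorusSite 2 L, ∑ q : TorusSite 2 L, star ((momentumCreation k 0 * momentumCreation q 1) *ᵥ ψ) ⬝ᵥ ((momentumCreation k 0 * momentumCreation q 1) *ᵥ ψ) = (((L : ℂ) ^ 2 - m)) ^ 2 :=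
  fun _ _ _ _ hψ hψ1 => sum_normSq_pairCreator_mulVec hψ hψ1

end Torus

end Summit.HubbardSuperconductivity.TwTipContinuation.IsogapTransport
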